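import Summits.MatrixMultiplication.MatrixMultiplication.Theorems.ObstructionCalculusSchurWeylDegree

set_option linter.dupNamespace false
set_option autoImplicit false

/-!
# Obstruction descent — universal occurrence is decided on the GENERATORS of the occurrence semigroup, in degrees `> m`
# (decomp-mm · lens 3 · gen 32, second kernel, def-free)

`route-MatrixMultiplication-ObstructionDescent`, crux `NoOccurrenceObstruction` (`P_O`, stmt 29040); NODE-g32 §2.  Companion of
`ObstructionDescentUniversalOccurrence.lean` (same generation), which typed UNIVERSAL OCCURRENCE

  `UOCC(m,N) :  S(s) ⊆ S(⟨m⟩)  for every tensor s of format ≤ N`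

(spelled literally, as there), proved `P_O ⟸ UOCC-family`, and the fill / Lickteig / BI-Lemma-6.1 rungs.  By Bürgisser–Ikenmeyer's
Lemma 3.2 the union `K(N) := ⋃_s S(s)` over all format-`N` tensors is the (finitely generated) Kronecker semigroup of the format, so
`UOCC(m,N)` says `K(N) ⊆ S(⟨m⟩)`.  This file proves the two structural facts that turn `UOCC(m,N)` into a FINITE question about `⟨m⟩`:

§1  **Low degrees are automatic** (`uocc_of_degree_le`): for `N ≤ m`, every triple of degree `d ≤ m` occurring for some tensor of
    format `≤ N` occurs for `⟨m⟩` — the calculus' degree engine `I(σ_m)_{≤ m} = 0` (`hwvSpace_eq_bot_of_degree_le`, pushed through the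
    Schur–Weyl bridge as `isotypicSum_kroneckerPow_unitTensor_ne_zero_of_degree_le`, gen 29) after zero-padding the format.  So every
    failure of `UOCC(m,N)` has degree `> m`.
§2  **Generators decide** (`uocc_iff_generators`): `UOCC(m,N)` holds iff every triple `λ` of degree `d > m` occurring for some
    format-`N` tensor EITHER occurs for `⟨m⟩` OR is a row-wise sum (`Nat.Partition.rowAdd`) of two triples of positive degrees each
    occurring for some format-`N` tensor (strong induction on the degree; `S(⟨m⟩)` is a semigroup:
    `isotypicSum₁₂₃_kroneckerPow_ne_zero_rowAdd`).  Equivalently: **`UOCC(m,N)` iff the INDECOMPOSABLE elements (Hilbert-basis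
    generators) of `K(N)` of degree `> m` lie in `S(⟨m⟩)`** — a finite set of highest-weight-vector evaluations on `σ_m` — and a
    minimal-degree occurrence obstruction against `⟨m⟩` among all format-`N` tensors is always a generator of `K(N)`.  In particular
    (`uocc_of_generated_le`) **`u(N) ≤ max(N, D(N))`** where `u(N)` is the universal-occurrence threshold of the companion file and `D(N)`
    the largest degree of a generator of `K(N)`: a purely COMBINATORIAL (Kronecker-coefficient) upper bound for the format from which
    on occurrence obstructions are blind for every tensor of format `N`.  This is the generator argument of BI 2011 §10.4 (proof of
    Lemma 3.2: generic tensors realise `K(m)`) run for the unit tensor instead of a generic tensor, with the degree engine supplying the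
    generators of degree `≤ m` for free.
Instrument reading (NODE-g32 §3): `u(4) = 6 ⟺ UOCC(6,4) ⟺` the generators of `K(4,4,4)` of degree `≥ 7` occur for `⟨6⟩` (by
Hauenstein–Ikenmeyer–Landsberg `I(σ_6(4,4,4))_{<19} = 0` numerically, only degrees `≥ 19` can fail; their degree-19/20 equations
sit in isotypic components of multiplicity `31` resp. `> 1`, so are not occurrence obstructions by themselves).
No proposition is defined; no `def`; sorry-free; standard axioms.  Nothing here proves `ω = 2` or closes an item.
[cite: BurgisserIkenmeyer2011, §3.2, Lemma 3.2, §10.4, Lemma 10.18] [cite: LandsbergGCT2017, Prop. 8.3.4.1]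
[cite: HauensteinIkenmeyerLandsberg2013, §1] -/

noncomputable section

open scoped BigOperators

namespace Summit.MatrixMultiplication.MatrixMultiplication.Theorems.ObstructionCalculus

open Literature.Computability.AlgebraicComplexity (kroneckerPow isotypicSum₁ isotypicSum₂ isotypicSum₃ unitTensor
  isotypicSum₁₂₃_kroneckerPow_ne_zero_rowAdd)

/-! ## §1  Low degrees are automatic -/

/-- **`UOCC(m,N)` holds in degrees `d ≤ m`** (`N ≤ m`): a triple of degree `d ≤ m` occurring for a tensor of format `≤ N` occurs for
`⟨m⟩`.  Zero-pad the tensor to format `m` (occurrence is unchanged, `isotypicSum_kroneckerPow_padTensor_ne_zero_iff`) and apply the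
degree engine `S(t)_{≤ m} ⊆ S(⟨m⟩)` (`isotypicSum_kroneckerPow_unitTensor_ne_zero_of_degree_le`: `σ_m` has no equations of degree
`≤ m`).  Hence every failure of `UOCC(m,N)` has degree `> m`. [cite: LandsbergGCT2017, Prop. 8.3.4.1] [cite: BurgisserIkenmeyer2011, §3.1] -/
theorem uocc_of_degree_le {m N : ℕ} (hNm : N ≤ m) {ι : Type} [Fintype ι] (hι : Fintype.card ι ≤ N)
    (s : ι → ι → ι → ℂ) {d : ℕ} (hd : d ≤ m) (lam : Fin 3 → Nat.Partition d)
    (hocc : isotypicSum₁ (lam 0) (isotypicSum₂ (lam 1) (isotypicSum₃ (lam 2) (kroneckerPow s d))) ≠ 0) :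
    isotypicSum₁ (lam 0) (isotypicSum₂ (lam 1) (isotypicSum₃ (lam 2) (kroneckerPow (unitTensor ℂ m) d))) ≠ 0 := by
  classical
  have he : Function.Injective (fun i : ι => Fin.castLE (hι.trans hNm) (Fintype.equivFin ι i)) :=
    fun i j hij => (Fintype.equivFin ι).injective (Fin.castLE_injective (hι.trans hNm) hij)
  exact isotypicSum_kroneckerPow_unitTensor_ne_zero_of_degree_le hd _ lam
    ((isotypicSum_kroneckerPow_padTensor_ne_zero_iff he s lam).2 hocc)

/-! ## §2  Generators decide -/

/-- **`UOCC(m,N)` from the generator condition** (`N ≤ m`): if every triple of degree `d > m` occurring for some format-`N` tensor either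
occurs for `⟨m⟩` or is a row-wise sum of two triples of positive degrees each occurring for some format-`N` tensor, then `UOCC(m,N)`.
Strong induction on the degree: degrees `≤ m` by `uocc_of_degree_le`; a decomposable triple occurs for `⟨m⟩` because both summands do
(induction) and `S(⟨m⟩)` is closed under row-wise sums (`isotypicSum₁₂₃_kroneckerPow_ne_zero_rowAdd`); arbitrary index types of
cardinality `≤ N` are first zero-padded into `Fin N`.  (BI 2011 §10.4 runs this generator argument for a generic tensor.)
[cite: BurgisserIkenmeyer2011, §10.4, Lemma 10.18] [cite: LandsbergGCT2017, Prop. 8.3.4.1] -/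
theorem uocc_of_generators {m N : ℕ} (hNm : N ≤ m)
    (hgen : ∀ (d : ℕ) (lam : Fin 3 → Nat.Partition d), m < d →
      (∃ s : Fin N → Fin N → Fin N → ℂ, isotypicSum₁ (lam 0) (isotypicSum₂ (lam 1) (isotypicSum₃ (lam 2) (kroneckerPow s d))) ≠ 0) →
      isotypicSum₁ (lam 0) (isotypicSum₂ (lam 1) (isotypicSum₃ (lam 2) (kroneckerPow (unitTensor ℂ m) d))) ≠ 0 ∨
      ∃ (d₁ d₂ : ℕ) (_ : d₁ + d₂ = d) (lam₁ : Fin 3 → Nat.Partition d₁) (lam₂ : Fin 3 → Nat.Partition d₂),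
        0 < d₁ ∧ 0 < d₂ ∧
        (∃ s₁ : Fin N → Fin N → Fin N → ℂ, isotypicSum₁ (lam₁ 0) (isotypicSum₂ (lam₁ 1) (isotypicSum₃ (lam₁ 2) (kroneckerPow s₁ d₁))) ≠ 0) ∧
        (∃ s₂ : Fin N → Fin N → Fin N → ℂ, isotypicSum₁ (lam₂ 0) (isotypicSum₂ (lam₂ 1) (isotypicSum₃ (lam₂ 2) (kroneckerPow s₂ d₂))) ≠ 0) ∧
        ∀ j, (lam j).parts = ((lam₁ j).rowAdd (lam₂ j)).parts) :
    ∀ {ι : Type} [Fintype ι], Fintype.card ι ≤ N → ∀ (s : ι → ι → ι → ℂ) (d : ℕ)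
      (lam : Fin 3 → Nat.Partition d),
      isotypicSum₁ (lam 0) (isotypicSum₂ (lam 1) (isotypicSum₃ (lam 2) (kroneckerPow s d))) ≠ 0 →
      isotypicSum₁ (lam 0) (isotypicSum₂ (lam 1) (isotypicSum₃ (lam 2) (kroneckerPow (unitTensor ℂ m) d))) ≠ 0 := by
  suffices key : ∀ (d : ℕ) (lam : Fin 3 → Nat.Partition d),
      (∃ s : Fin N → Fin N → Fin N → ℂ, isotypicSum₁ (lam 0) (isotypicSum₂ (lam 1) (isotypicSum₃ (lam 2) (kroneckerPow s d))) ≠ 0) →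
      isotypicSum₁ (lam 0) (isotypicSum₂ (lam 1) (isotypicSum₃ (lam 2) (kroneckerPow (unitTensor ℂ m) d))) ≠ 0 by
    intro ι _ hι s d lam hocc
    classical
    have he : Function.Injective (fun i : ι => Fin.castLE hι (Fintype.equivFin ι i)) :=
      fun i j hij => (Fintype.equivFin ι).injective (Fin.castLE_injective hι hij)
    exact key d lam ⟨_, (isotypicSum_kroneckerPow_padTensor_ne_zero_iff he s lam).2 hocc⟩
  intro d
  induction d using Nat.strong_induction_on with
  | _ d ih =>
    rintro lam ⟨s, hs⟩
    by_cases hd : d ≤ m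
    · exact uocc_of_degree_le hNm (by simp) s hd lam hs
    · rcases hgen d lam (not_le.1 hd) ⟨s, hs⟩ with h | ⟨d₁, d₂, e, lam₁, lam₂, hd₁, hd₂, h₁, h₂, hparts⟩
      · exact h
      · subst e
        have o := isotypicSum₁₂₃_kroneckerPow_ne_zero_rowAdd (ih d₁ (by omega) lam₁ h₁) (ih d₂ (by omega) lam₂ h₂)
        have hlam : lam = fun j => (lam₁ j).rowAdd (lam₂ j) := funext fun j => Nat.Partition.ext (hparts j)
        rw [hlam]
        exact o

/-- The converse is immediate (take the first alternative): under `UOCC(m,N)` every occurring triple occurs for `⟨m⟩`. [bookkeeping]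
[cite: BurgisserIkenmeyer2011, §3.1] -/
theorem generators_of_uocc {m N : ℕ}
    (hU : ∀ {ι : Type} [Fintype ι], Fintype.card ι ≤ N → ∀ (s : ι → ι → ι → ℂ) (d : ℕ)
      (lam : Fin 3 → Nat.Partition d),
      isotypicSum₁ (lam 0) (isotypicSum₂ (lam 1) (isotypicSum₃ (lam 2) (kroneckerPow s d))) ≠ 0 →
      isotypicSum₁ (lam 0) (isotypicSum₂ (lam 1) (isotypicSum₃ (lam 2) (kroneckerPow (unitTensor ℂ m) d))) ≠ 0) :
    ∀ (d : ℕ) (lam : Fin 3 → Nat.Partition d), m < d →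
      (∃ s : Fin N → Fin N → Fin N → ℂ, isotypicSum₁ (lam 0) (isotypicSum₂ (lam 1) (isotypicSum₃ (lam 2) (kroneckerPow s d))) ≠ 0) →
      isotypicSum₁ (lam 0) (isotypicSum₂ (lam 1) (isotypicSum₃ (lam 2) (kroneckerPow (unitTensor ℂ m) d))) ≠ 0 ∨
      ∃ (d₁ d₂ : ℕ) (_ : d₁ + d₂ = d) (lam₁ : Fin 3 → Nat.Partition d₁) (lam₂ : Fin 3 → Nat.Partition d₂),
        0 < d₁ ∧ 0 < d₂ ∧
        (∃ s₁ : Fin N → Fin N → Fin N → ℂ, isotypicSum₁ (lam₁ 0) (isotypicSum₂ (lam₁ 1) (isotypicSum₃ (lam₁ 2) (kroneckerPow s₁ d₁))) ≠ 0) ∧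
        (∃ s₂ : Fin N → Fin N → Fin N → ℂ, isotypicSum₁ (lam₂ 0) (isotypicSum₂ (lam₂ 1) (isotypicSum₃ (lam₂ 2) (kroneckerPow s₂ d₂))) ≠ 0) ∧
        ∀ j, (lam j).parts = ((lam₁ j).rowAdd (lam₂ j)).parts :=
  fun d lam _ ⟨s, hs⟩ => Or.inl (hU (by simp) s d lam hs)

/-- **Generators decide universal occurrence** (`N ≤ m`): `UOCC(m,N)` iff every triple of degree `> m` occurring for some format-`N`
tensor occurs for `⟨m⟩` or decomposes, inside the format-`N` occurrence semigroup `K(N)`, as a row-wise sum of two triples of positive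
degrees.  Reading: `UOCC(m,N)` iff the indecomposable elements of `K(N)` of degree `> m` lie in `S(⟨m⟩)`; a minimal-degree occurrence
obstruction against `⟨m⟩` in format `N` is a generator of `K(N)`. [cite: BurgisserIkenmeyer2011, §3.2, §10.4, Lemma 10.18]
[cite: LandsbergGCT2017, Prop. 8.3.4.1] -/
theorem uocc_iff_generators {m N : ℕ} (hNm : N ≤ m) :
    (∀ {ι : Type} [Fintype ι], Fintype.card ι ≤ N → ∀ (s : ι → ι → ι → ℂ) (d : ℕ)
      (lam : Fin 3 → Nat.Partition d),
      isotypicSum₁ (lam 0) (isotypicSum₂ (lam 1) (isotypicSum₃ (lam 2) (kroneckerPow s d))) ≠ 0 →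
      isotypicSum₁ (lam 0) (isotypicSum₂ (lam 1) (isotypicSum₃ (lam 2) (kroneckerPow (unitTensor ℂ m) d))) ≠ 0) ↔
    ∀ (d : ℕ) (lam : Fin 3 → Nat.Partition d), m < d →
      (∃ s : Fin N → Fin N → Fin N → ℂ, isotypicSum₁ (lam 0) (isotypicSum₂ (lam 1) (isotypicSum₃ (lam 2) (kroneckerPow s d))) ≠ 0) →
      isotypicSum₁ (lam 0) (isotypicSum₂ (lam 1) (isotypicSum₃ (lam 2) (kroneckerPow (unitTensor ℂ m) d))) ≠ 0 ∨
      ∃ (d₁ d₂ : ℕ) (_ : d₁ + d₂ = d) (lam₁ : Fin 3 → Nat.Partition d₁) (lam₂ : Fin 3 → Nat.Partition d₂),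
        0 < d₁ ∧ 0 < d₂ ∧
        (∃ s₁ : Fin N → Fin N → Fin N → ℂ, isotypicSum₁ (lam₁ 0) (isotypicSum₂ (lam₁ 1) (isotypicSum₃ (lam₁ 2) (kroneckerPow s₁ d₁))) ≠ 0) ∧
        (∃ s₂ : Fin N → Fin N → Fin N → ℂ, isotypicSum₁ (lam₂ 0) (isotypicSum₂ (lam₂ 1) (isotypicSum₃ (lam₂ 2) (kroneckerPow s₂ d₂))) ≠ 0) ∧
        ∀ j, (lam j).parts = ((lam₁ j).rowAdd (lam₂ j)).parts :=
  ⟨fun hU => generators_of_uocc hU, uocc_of_generators hNm⟩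

/-- **`u(N) ≤ max(N, D(N))`**: if the format-`N` occurrence semigroup `K(N)` is GENERATED IN DEGREES `≤ m` (every occurring triple of
degree `> m` is a row-wise sum of two occurring triples of positive degrees) and `N ≤ m`, then `UOCC(m,N)`: occurrence obstructions
against `⟨m⟩` are blind for every tensor of format `N`.  A purely combinatorial sufficient condition (generation degree of the
Kronecker semigroup), the geometric input being only `I(σ_m)_{≤m} = 0`. [cite: BurgisserIkenmeyer2011, §3.2, Lemma 3.2, §10.4]
[cite: LandsbergGCT2017, Prop. 8.3.4.1] -/
theorem uocc_of_generated_le {m N : ℕ} (hNm : N ≤ m)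
    (hgen : ∀ (d : ℕ) (lam : Fin 3 → Nat.Partition d), m < d →
      (∃ s : Fin N → Fin N → Fin N → ℂ, isotypicSum₁ (lam 0) (isotypicSum₂ (lam 1) (isotypicSum₃ (lam 2) (kroneckerPow s d))) ≠ 0) →
      ∃ (d₁ d₂ : ℕ) (_ : d₁ + d₂ = d) (lam₁ : Fin 3 → Nat.Partition d₁) (lam₂ : Fin 3 → Nat.Partition d₂),
        0 < d₁ ∧ 0 < d₂ ∧
        (∃ s₁ : Fin N → Fin N → Fin N → ℂ, isotypicSum₁ (lam₁ 0) (isotypicSum₂ (lam₁ 1) (isotypicSum₃ (lam₁ 2) (kroneckerPow s₁ d₁))) ≠ 0) ∧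
        (∃ s₂ : Fin N → Fin N → Fin N → ℂ, isotypicSum₁ (lam₂ 0) (isotypicSum₂ (lam₂ 1) (isotypicSum₃ (lam₂ 2) (kroneckerPow s₂ d₂))) ≠ 0) ∧
        ∀ j, (lam j).parts = ((lam₁ j).rowAdd (lam₂ j)).parts) :
    ∀ {ι : Type} [Fintype ι], Fintype.card ι ≤ N → ∀ (s : ι → ι → ι → ℂ) (d : ℕ)
      (lam : Fin 3 → Nat.Partition d),
      isotypicSum₁ (lam 0) (isotypicSum₂ (lam 1) (isotypicSum₃ (lam 2) (kroneckerPow s d))) ≠ 0 →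
      isotypicSum₁ (lam 0) (isotypicSum₂ (lam 1) (isotypicSum₃ (lam 2) (kroneckerPow (unitTensor ℂ m) d))) ≠ 0 :=
  uocc_of_generators hNm fun d lam hd hex => Or.inr (hgen d lam hd hex)

end Summit.MatrixMultiplication.MatrixMultiplication.Theorems.ObstructionCalculus

end
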